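import Mathlib
import Summits.SmoothPoincare4.SmoothPoincare4.Theorems.CylinderEntropySliceIsolationCertChecker
import HarnessLib

/-!
# The certificate checker of the conformal kernel domination, II: soundness of the atom and kernel bounds

File II of III on the computable checker `Cert.checkCover` (line `conformal-kernel-domination` of the crux
`Summit.SmoothPoincare4.SmoothPoincare4.Theses.CylinderEntropy.SliceIsolation`, crux item stmt-SmoothPoincare4-7632,
stubs `stub_certMidA/B/C`).  Proved here: validated atoms have `0 < q < 1`, `0 ≤ w`, `0 < tlo ≤ τ`
(`Cert.atomOK_sound`); the sharp-tail series minorant (`Cert.zonalLoSharpR_le_zonal`); every zonal-table entry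
minorises `zonal(τ, ·)` on `[g_i, 1]` (`Cert.zonalLoAt_le`, `Cert.table_le`: series partial sums with geometric
tail, or Hamilton's pole minorant with the certified `arccos²` bound); the certified atom / atom-list lower bounds
over a box (`Cert.atomLo_le`, `Cert.atomsLo_le`); and the certified kernel UPPER bound over a cell × box
(`Cert.pulled_le_pulledHi`: exact `T`-envelope `helper_certTsup` at the certified `Q`-bound `Cert.Q_lower`).
No definitions, no named facts.
-/

-- the registered namespace `Summit.SmoothPoincare4.SmoothPoincare4.Theorems…` repeats a component
set_option linter.dupNamespace false

namespace Summit.SmoothPoincare4.SmoothPoincare4.Theorems.CylinderEntropySliceIsolation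

open Literature.Geometry.Riemannian.SphericalCylinderEntropy
  Literature.Geometry.Riemannian.SphericalZonalKernelSeries

namespace Cert

variable (C : Cell)

/-! ### Atoms: validity consequences -/

/-- A validated atom has `0 < q < 1`, `0 ≤ w`, `0 < tlo ≤ τ`. [folklore] -/
theorem atomOK_sound {a : Atom} (h : atomOK C a = true) :
    0 < a.q ∧ a.q < 1 ∧ 0 ≤ a.w ∧ 0 < a.tlo ∧ (a.tlo : ℝ) ≤ a.tau ∧
      (a.mode = 1 → 32 * a.q ^ ((a.K + 4) / 2) < 1) ∧ (a.mode = 2 → sharpOK a.q a.K = true) := by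
  simp only [atomOK, Bool.and_eq_true, decide_eq_true_eq, Bool.or_eq_true, Bool.not_eq_true',
    decide_eq_false_iff_not] at h
  obtain ⟨⟨⟨⟨⟨⟨hq0, hq1⟩, hw⟩, ht⟩, hqe⟩, hser⟩, hsharp⟩ := h
  refine ⟨hq0, hq1, hw, ht, ?_, ?_, ?_⟩
  · have h1 : ((a.q : ℚ) : ℝ) ≤ Real.exp (-2 * (a.tlo : ℝ)) := by
      have := expLo_le (-2 * a.tlo) C.prec
      push_cast at this
      exact le_trans (by exact_mod_cast hqe) this
    exact le_neg_log_div_two _ _ (by exact_mod_cast hq0) h1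
  · intro hs
    rcases hser with hser | hser
    · exact absurd hs hser
    · exact hser
  · intro hs
    rcases hsharp with hsharp | hsharp
    · exact absurd hs hsharp
    · exact hsharp

/-- `0 < τ` for a validated atom. [folklore] -/
theorem tau_pos {a : Atom} (h : atomOK C a = true) : 0 < a.tau := by
  obtain ⟨hq0, hq1, -, -, -, -, -⟩ := atomOK_sound C h
  exact neg_log_div_two_pos (by exact_mod_cast hq0) (by exact_mod_cast hq1)

/-- The value of a validated atom is nonnegative on `s ∈ [-1, 1]`. [folklore] -/
theorem val_nonneg {a : Atom} (h : atomOK C a = true) {u s : ℝ} (hs1 : -1 ≤ s) (hs2 : s ≤ 1) :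
    0 ≤ a.val u s := by
  obtain ⟨-, -, hw, -, -, -, -⟩ := atomOK_sound C h
  have hz : 0 ≤ zonal a.tau s := zonal_nonneg (tau_pos C h) s ⟨hs1, hs2⟩
  unfold Atom.val
  exact mul_nonneg (by exact_mod_cast hw) (mul_nonneg hz (Real.exp_pos _).le)

/-! ### The sharp series minorant -/

/-- `zonalPartialLoR ≤ zonalPartialQ` (the rounded one-pass sum minorises the exact one). [folklore] -/
theorem zonalPartialLoR_le (q s : ℚ) (K p : ℕ) (hq : 0 ≤ q) :
    zonalPartialLoR q s K p ≤ zonalPartialQ q s K := by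
  rw [zonalPartialLoR, zonalPartialQ, zonalState_eq]
  exact (zonalStateR_le q s p hq (K + 1)).2.2

/-- **Soundness of the sharp series lower bound** at the point `s ∈ [-1, 1]`. [folklore] -/
theorem zonalLoSharpR_le_zonal {q s : ℚ} (K p : ℕ) (hq0 : 0 < q) (hq1 : q < 1)
    (hr : sharpOK q K = true) (hs1 : -1 ≤ s) (hs2 : s ≤ 1) :
    ((zonalLoSharpR q s K p : ℚ) : ℝ) ≤ zonal (-(Real.log (q : ℝ)) / 2) (s : ℝ) := by
  have hq0' : (0 : ℝ) < (q : ℝ) := by exact_mod_cast hq0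
  have hq1' : ((q : ℚ) : ℝ) < 1 := by exact_mod_cast hq1
  have hs : |((s : ℚ) : ℝ)| ≤ 1 := abs_le.2 ⟨by exact_mod_cast hs1, by exact_mod_cast hs2⟩
  simp only [sharpOK, decide_eq_true_eq] at hr
  have hr' : ((q : ℚ) : ℝ) ^ (K + 3) * ((2 * (K : ℝ) + 7) * ((K : ℝ) + 3) * ((K : ℝ) + 4)) <
      (2 * (K : ℝ) + 5) * ((K : ℝ) + 2) * ((K : ℝ) + 3) := by exact_mod_cast hr
  have h := partialSum_sub_sharp_le_zonal hq0' hq1' K hs hr'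
  have hle : ((zonalLoSharpR q s K p : ℚ) : ℝ) ≤ ((zonalPartialQ q s K - sharpTailQ q K : ℚ) : ℝ) := by
    exact_mod_cast sub_le_sub_right (zonalPartialLoR_le q s K p hq0.le) _
  refine hle.trans (le_of_eq_of_le ?_ h)
  rw [Rat.cast_sub, zonalPartialQ_cast, sharpTailQ]
  push_cast
  ring

/-- The sharp series lower bound at `s` minorises `zonal (-(log q)/2)` on `[s, 1]`. [folklore] -/
theorem zonalLoSharpR_le_zonal_of_le {q s : ℚ} (K p : ℕ) (hq0 : 0 < q) (hq1 : q < 1)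
    (hr : sharpOK q K = true) (hs1 : -1 ≤ s) (hs2 : s ≤ 1) {t : ℝ} (hst : ((s : ℚ) : ℝ) ≤ t)
    (ht1 : t ≤ 1) : ((zonalLoSharpR q s K p : ℚ) : ℝ) ≤ zonal (-(Real.log (q : ℝ)) / 2) t :=
  le_zonal_of_le_zonal hq0 hq1 (by exact_mod_cast hs1) hst ht1
    (zonalLoSharpR_le_zonal K p hq0 hq1 hr hs1 hs2)

/-! ### The zonal table -/

/-- `arccos(g)² ≤ theta2Hi g p` for `g ∈ [-1, 1]`. [folklore] -/
theorem arccos_sq_le_theta2Hi (g : ℚ) (p : ℕ) (hg2 : (g : ℝ) ≤ 1) :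
    Real.arccos (g : ℝ) ^ 2 ≤ ((theta2Hi g p : ℚ) : ℝ) := by
  unfold theta2Hi
  split_ifs with h
  · have h' : -1 / 2 ≤ ((g : ℚ) : ℝ) := by exact_mod_cast h
    have hs := sqrtLo_le (3 + 6 * g) p
    push_cast at hs ⊢
    linarith [arccos_sq_le (g : ℝ) h' hg2]
  · push_cast
    exact arccos_sq_le_ten _

/-- **Table entry soundness**: for a validated atom and `g ∈ [-1, 1]`, `zonalLoAt a g p` minorises
`zonal(τ_a, t)` for every `t ∈ [g, 1]`. [folklore] -/
theorem zonalLoAt_le {a : Atom} (h : atomOK C a = true) (g : ℚ) (p : ℕ) (hg1 : -1 ≤ g) (hg2 : g ≤ 1)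
    {t : ℝ} (hgt : ((g : ℚ) : ℝ) ≤ t) (ht1 : t ≤ 1) :
    ((zonalLoAt a g p : ℚ) : ℝ) ≤ zonal a.tau t := by
  obtain ⟨hq0, hq1, -, htlo, htau, hser, hsharp⟩ := atomOK_sound C h
  have hτ := tau_pos C h
  have ht0 : -1 ≤ t := le_trans (by exact_mod_cast hg1) hgt
  unfold zonalLoAt
  push_cast
  refine max_le (zonal_nonneg hτ t ⟨ht0, ht1⟩) ?_
  split_ifs with hm hm2
  · exact zonalLoSeriesR_le_zonal_of_le a.K p hq0 hq1 (hser hm) hg1 hg2 hgt ht1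
  · exact zonalLoSharpR_le_zonal_of_le a.K p hq0 hq1 (hsharp hm2) hg1 hg2 hgt ht1
  · refine le_trans (rdn_le_real _ _) ?_
    push_cast
    have hΘ : Real.arccos t ^ 2 ≤ ((theta2Hi g p : ℚ) : ℝ) := by
      have hmono : Real.arccos t ≤ Real.arccos (g : ℝ) := Real.arccos_le_arccos hgt |>.trans_eq rfl
      have h0 : 0 ≤ Real.arccos t := Real.arccos_nonneg t
      exact le_trans (pow_le_pow_left₀ h0 hmono 2) (arccos_sq_le_theta2Hi g p (by exact_mod_cast hg2))
    have hpole := zonalPoleLo_le a.q a.K hq0 hq1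
    have hexp := expLo_le (-(theta2Hi g p) / (4 * a.tlo)) p
    have hgauss := zonal_pole_gauss_le a.tau (a.tlo : ℝ) ((theta2Hi g p : ℚ) : ℝ) t
      (by exact_mod_cast htlo) htau ht0 ht1 hΘ
    have hx : ((-(theta2Hi g p) / (4 * a.tlo) : ℚ) : ℝ) = -((theta2Hi g p : ℚ) : ℝ) / (4 * (a.tlo : ℝ)) := by
      push_cast; ring
    rw [hx] at hexp
    calc ((zonalPoleLo a.q a.K : ℚ) : ℝ) * ((expLo (-theta2Hi g p / (4 * a.tlo)) p : ℚ) : ℝ)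
        ≤ zonal a.tau 1 * Real.exp (-((theta2Hi g p : ℚ) : ℝ) / (4 * (a.tlo : ℝ))) :=
          mul_le_mul hpole hexp (by exact_mod_cast expLo_nonneg _ _)
            (le_trans (by exact_mod_cast zonalPoleLo_nonneg a.q a.K hq0.le) hpole)
      _ ≤ zonal a.tau t := hgauss

/-- **Table soundness**: the looked-up entry minorises `zonal(τ_a, s)` for all `s ∈ [s1, 1]`,
`s1 ≥ -1`. [folklore] -/
theorem table_le {a : Atom} (h : atomOK C a = true) {s1 : ℚ} (hs1 : -1 ≤ s1) {s : ℝ}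
    (hs : ((s1 : ℚ) : ℝ) ≤ s) (hs2 : s ≤ 1) :
    (((zonalTable C a).getD (tableIdx C.ns s1) 0 : ℚ) : ℝ) ≤ zonal a.tau s := by
  obtain ⟨hlt, hle⟩ := tableIdx_spec C.ns s1 hs1
  have hsize : (zonalTable C a).size = 2 ^ C.ns := by simp [zonalTable]
  have hget : (zonalTable C a).getD (tableIdx C.ns s1) 0 =
      zonalLoAt a (gridPt C.ns (tableIdx C.ns s1)) C.prec := by
    rw [Array.getD_eq_getD_getElem?, Array.getElem?_eq_getElem (hsize ▸ hlt)]
    simp [zonalTable]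
  rw [hget]
  obtain ⟨hg1, hg2⟩ := gridPt_mem C.ns _ hlt
  exact zonalLoAt_le C h _ _ hg1 hg2 (le_trans (by exact_mod_cast hle) hs) hs2

/-! ### One atom, a list of atoms -/

/-- **Atom soundness** over a box `u ∈ [u1, u2]`, `s ∈ [s1, 1]` (`s1 ≥ -1`). [folklore] -/
theorem atomLo_le {a : Atom} (h : atomOK C a = true) {u1 u2 s1 : ℚ} (hs1 : -1 ≤ s1) {u s : ℝ}
    (hu1 : ((u1 : ℚ) : ℝ) ≤ u) (hu2 : u ≤ ((u2 : ℚ) : ℝ)) (hs : ((s1 : ℚ) : ℝ) ≤ s) (hs2 : s ≤ 1) :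
    ((atomLo C a (zonalTable C a) u1 u2 s1 : ℚ) : ℝ) ≤ a.val u s := by
  obtain ⟨hq0, hq1, hw, htlo, htau, -, -⟩ := atomOK_sound C h
  have hs0 : -1 ≤ s := le_trans (by exact_mod_cast hs1) hs
  have hval := val_nonneg C h (u := u) hs0 hs2
  unfold atomLo
  simp only
  split_ifs with hz
  · push_cast; exact hval
  · push_cast
    have hz' : 0 < (((zonalTable C a).getD (tableIdx C.ns s1) 0 : ℚ) : ℝ) := by exact_mod_cast (not_le.1 hz)
    have htab := table_le C h hs1 hs hs2
    have hgauss := exp_quad_lower u (u1 : ℝ) (u2 : ℝ) (a.σ : ℝ) a.tau (a.tlo : ℝ) (by exact_mod_cast htlo)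
      htau hu1 hu2
    have hexp := expLo_le (-(max |u1 - a.σ| |u2 - a.σ|) ^ 2 / (4 * a.tlo)) C.prec
    have hx : (((-(max |u1 - a.σ| |u2 - a.σ|) ^ 2 / (4 * a.tlo)) : ℚ) : ℝ) =
        -(max |(u1 : ℝ) - (a.σ : ℝ)| |(u2 : ℝ) - (a.σ : ℝ)|) ^ 2 / (4 * (a.tlo : ℝ)) := by
      push_cast; ring
    rw [hx] at hexp
    unfold Atom.val
    have hw' : (0 : ℝ) ≤ (a.w : ℝ) := by exact_mod_cast hw
    rw [mul_assoc]
    refine mul_le_mul_of_nonneg_left ?_ hw'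
    exact mul_le_mul htab (hexp.trans hgauss) (by exact_mod_cast expLo_nonneg _ _) (hz'.le.trans htab)

/-- **Atoms soundness**: the certified sum minorises the real sum (tables computed by `zonalTable`).
[folklore] -/
theorem atomsLo_le (as : List Atom) (hall : atomsOK C as = true) {u1 u2 s1 : ℚ} (hs1 : -1 ≤ s1)
    {u s : ℝ} (hu1 : ((u1 : ℚ) : ℝ) ≤ u) (hu2 : u ≤ ((u2 : ℚ) : ℝ)) (hs : ((s1 : ℚ) : ℝ) ≤ s)
    (hs2 : s ≤ 1) :
    ((atomsLo C as (as.map (zonalTable C)) u1 u2 s1 : ℚ) : ℝ) ≤ atomsVal as u s := by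
  induction as with
  | nil => simp [atomsLo, atomsVal]
  | cons a as ih =>
    simp only [atomsOK, Bool.and_eq_true] at hall
    simp only [List.map_cons, atomsLo, atomsVal]
    push_cast
    exact add_le_add (atomLo_le C hall.1 hs1 hu1 hu2 hs hs2) (ih hall.2)

/-- The real value of a validated list of atoms is nonnegative on `s ∈ [-1, 1]`. [folklore] -/
theorem atomsVal_nonneg (as : List Atom) (hall : atomsOK C as = true) {u s : ℝ} (hs1 : -1 ≤ s)
    (hs2 : s ≤ 1) : 0 ≤ atomsVal as u s := by
  induction as with
  | nil => simp [atomsVal]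
  | cons a as ih =>
    simp only [atomsOK, Bool.and_eq_true] at hall
    simp only [atomsVal]
    exact add_nonneg (val_nonneg C hall.1 hs1 hs2) (ih hall.2)

/-! ### The kernel upper bound -/

/-- **Kernel soundness**: `pulledHi` majorises `pulled(T, u, s)` over the cell and the box. [folklore] -/
theorem pulled_le_pulledHi (hT1 : 0 < C.T1) {u1 u2 s2 : ℚ} (hs2 : s2 ≤ 1)
    {T u s : ℝ} (hT : ((C.T1 : ℚ) : ℝ) ≤ T) (hT' : T ≤ ((C.T2 : ℚ) : ℝ)) (hu1 : ((u1 : ℚ) : ℝ) ≤ u)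
    (hu2 : u ≤ ((u2 : ℚ) : ℝ)) (hs1 : -1 ≤ s) (hs : s ≤ ((s2 : ℚ) : ℝ)) :
    pulledR T u s ≤ ((pulledHi C u1 u2 s2 : ℚ) : ℝ) := by
  have hT1r : (0 : ℝ) < (C.T1 : ℝ) := by exact_mod_cast hT1
  have hTpos : 0 < T := hT1r.trans_le hT
  -- the pieces of `pulledHi`
  set a : ℚ := expLo u1 C.prec with ha
  set b : ℚ := expHi u2 C.prec with hb
  set r : ℚ := clampQ s2 a b with hr
  set Qlo : ℚ := (r - s2) ^ 2 + (1 - s2 ^ 2) with hQlo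
  set Tc : ℚ := clampQ (Qlo / 8) C.T1 C.T2 with hTc
  have hpull : pulledHi C u1 u2 s2 =
      rup (1 / 6 * expHi (4 * u2) C.prec * expHi (-Qlo / (4 * Tc)) C.prec / Tc ^ 2) C.prec := rfl
  -- real facts
  have har : ((a : ℚ) : ℝ) ≤ Real.exp u :=
    (expLo_le u1 C.prec).trans (Real.exp_le_exp.2 hu1)
  have hbr : Real.exp u ≤ ((b : ℚ) : ℝ) :=
    (Real.exp_le_exp.2 hu2).trans (exp_le_expHi u2 C.prec)
  have hQ : ((Qlo : ℚ) : ℝ) ≤ Real.exp (2 * u) - 2 * Real.exp u * s + 1 := by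
    have h := Q_lower u s (s2 : ℝ) (a : ℝ) (b : ℝ) har hbr hs
    have hcast : ((Qlo : ℚ) : ℝ) = (max (a : ℝ) (min (s2 : ℝ) (b : ℝ)) - (s2 : ℝ)) ^ 2 + (1 - (s2 : ℝ) ^ 2) := by
      rw [hQlo, hr, clampQ]; push_cast; ring
    rw [hcast]; exact h
  have hs2r : ((s2 : ℚ) : ℝ) ≤ 1 := by exact_mod_cast hs2
  have hs2l : -1 ≤ ((s2 : ℚ) : ℝ) := hs1.trans hs
  have hQlo0 : (0 : ℝ) ≤ ((Qlo : ℚ) : ℝ) := by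
    push_cast [hQlo]
    nlinarith [sq_nonneg (((r : ℚ) : ℝ) - (s2 : ℝ))]
  have hTcdef : ((Tc : ℚ) : ℝ) = max (C.T1 : ℝ) (min (((Qlo : ℚ) : ℝ) / 8) (C.T2 : ℝ)) := by
    rw [hTc, clampQ]; push_cast; ring_nf
  have hTcpos : (0 : ℝ) < ((Tc : ℚ) : ℝ) := by rw [hTcdef]; exact lt_max_of_lt_left hT1r
  have henv := helper_certTsup (C.T1 : ℝ) (C.T2 : ℝ) T _ _ hT1r hT hT' hQlo0 hQ
  rw [← hTcdef] at henv
  -- assemble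
  have hpre := pulled_prefactor T hTpos.ne'
  unfold pulledR
  rw [hpre]
  have h4u : Real.exp (4 * u) ≤ ((expHi (4 * u2) C.prec : ℚ) : ℝ) := by
    have := exp_le_expHi (4 * u2) C.prec
    push_cast at this
    exact (Real.exp_le_exp.2 (by linarith)).trans this
  have hexpQ : Real.exp (-((Qlo : ℚ) : ℝ) / (4 * ((Tc : ℚ) : ℝ))) ≤ ((expHi (-Qlo / (4 * Tc)) C.prec : ℚ) : ℝ) := by
    have := exp_le_expHi (-Qlo / (4 * Tc)) C.prec
    push_cast at this ⊢
    exact this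
  have key : (6 * T ^ 2)⁻¹ * Real.exp (4 * u) *
      Real.exp (-(Real.exp (2 * u) - 2 * Real.exp u * s + 1) / (4 * T)) ≤
      1 / 6 * ((expHi (4 * u2) C.prec : ℚ) : ℝ) * ((expHi (-Qlo / (4 * Tc)) C.prec : ℚ) : ℝ) /
        ((Tc : ℚ) : ℝ) ^ 2 := by
    have hsplit : (6 * T ^ 2)⁻¹ * Real.exp (4 * u) *
        Real.exp (-(Real.exp (2 * u) - 2 * Real.exp u * s + 1) / (4 * T)) =
        1 / 6 * Real.exp (4 * u) *
          ((T ^ 2)⁻¹ * Real.exp (-(Real.exp (2 * u) - 2 * Real.exp u * s + 1) / (4 * T))) := by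
      field_simp
    rw [hsplit]
    have hrhs : 1 / 6 * ((expHi (4 * u2) C.prec : ℚ) : ℝ) * ((expHi (-Qlo / (4 * Tc)) C.prec : ℚ) : ℝ) /
        ((Tc : ℚ) : ℝ) ^ 2 = 1 / 6 * ((expHi (4 * u2) C.prec : ℚ) : ℝ) *
          ((((Tc : ℚ) : ℝ) ^ 2)⁻¹ * ((expHi (-Qlo / (4 * Tc)) C.prec : ℚ) : ℝ)) := by
      field_simp
    rw [hrhs]
    have henv' : (T ^ 2)⁻¹ * Real.exp (-(Real.exp (2 * u) - 2 * Real.exp u * s + 1) / (4 * T)) ≤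
        (((Tc : ℚ) : ℝ) ^ 2)⁻¹ * ((expHi (-Qlo / (4 * Tc)) C.prec : ℚ) : ℝ) :=
      henv.trans (mul_le_mul_of_nonneg_left hexpQ (by positivity))
    have hnn : 0 ≤ (T ^ 2)⁻¹ * Real.exp (-(Real.exp (2 * u) - 2 * Real.exp u * s + 1) / (4 * T)) := by
      positivity
    have hE0 : (0 : ℝ) ≤ ((expHi (4 * u2) C.prec : ℚ) : ℝ) := (Real.exp_pos _).le.trans h4u
    exact mul_le_mul (mul_le_mul_of_nonneg_left h4u (by norm_num)) henv' hnn
      (mul_nonneg (by norm_num) hE0)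
  rw [hpull]
  have hfin := le_rup_real (1 / 6 * expHi (4 * u2) C.prec * expHi (-Qlo / (4 * Tc)) C.prec / Tc ^ 2) C.prec
  push_cast at hfin
  exact key.trans hfin


end Cert

/-- Registered helper `helper_certPulledHi` of crux stmt-SmoothPoincare4-7632: the certified kernel upper bound of the
certificate checker majorises the pulled-back kernel over a cell and a box. [folklore] -/
theorem helper_certPulledHi : ∀ (C : Cert.Cell), 0 < C.T1 → ∀ (u1 u2 s2 : ℚ), s2 ≤ 1 → ∀ (T u s : ℝ),
    ((C.T1 : ℚ) : ℝ) ≤ T → T ≤ ((C.T2 : ℚ) : ℝ) → ((u1 : ℚ) : ℝ) ≤ u → u ≤ ((u2 : ℚ) : ℝ) → -1 ≤ s →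
    s ≤ ((s2 : ℚ) : ℝ) → Cert.pulledR T u s ≤ ((Cert.pulledHi C u1 u2 s2 : ℚ) : ℝ) :=
  fun C hT1 _ _ _ hs2 _ _ _ hT hT' hu1 hu2 hs1 hs => Cert.pulled_le_pulledHi C hT1 hs2 hT hT' hu1 hu2 hs1 hs

end Summit.SmoothPoincare4.SmoothPoincare4.Theorems.CylinderEntropySliceIsolation
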